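import Summits.BirchSwinnertonDyer.Rank1Residual.X2.ParitySqueeze
import Summits.BirchSwinnertonDyer.Rank1Residual.X2.LambdaMinimal
import Summits.BirchSwinnertonDyer.Rank1Residual.X1.RankOneParitySqueeze
import Literature.NumberTheory.EllipticCurves.BSDRankResidualCellsProofs
import HarnessLib

/-!
# Class X2 (odd multiplicative Eisenstein prime): route P at RANK ONE — the parity squeeze at
# `λ_an = 3 + e` ⇒ the cyclotomic main conjecture at an X2c pair
# (cell `b2b-bsdres`, unit `b2b-bsdres-eisenstein-p2`, gen 5)

HONEST FRAMING (run/shared/lean/b2b/bsd-rank1-residual/, verbatim in every file): the goal of the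
cell is to DELETE the COMBINATION-SHAPED residual classes of the Birch–Swinnerton-Dyer formula for
ALL analytic-rank `≤ 1` elliptic curves over `ℚ` — "full BSD formula for every rank `≤ 1` curve in
class `C`" assembled STRICTLY from published theorems — so that the rank-`≤ 1` remainder becomes
exactly the CONSTRUCTION-SHAPED classes, which are TYPED (missing-input `Prop`s), NOT attempted.
This is not "finishing BSD". Research route; NO CLAIM BEYOND STATED CLASSES; nothing here changes
a label; X2c stays CONSTRUCTION-SHAPED. Theorems only (no definition, no named fact): the published
theorems enter as the tree's existing NAMED FACTS, taken as hypotheses.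

WHY THIS FILE. Gen 4 transposed Greenberg's parity squeeze (LNM 1716 §5 p. 183, `147b1@13`) to
`p ‖ N` in RANK ZERO (`X2/ParitySqueeze.lean`, λ-excess `2`) and filed the no-excess case in both
ranks (`X2/LambdaMinimal.lean`); x1b filed the rank-ONE squeeze at a GOOD ordinary prime
(`X1/RankOneParitySqueeze.lean`, p205925). This file is the remaining corner: RANK ONE at `p ‖ N`,
λ-excess `2`, i.e. `λ_an = 3 + e` (`e = 1` split — the trivial zero counts — `0` non-split).
Wuthrich 2014 Thm. 16: `ϖ·L = ι(T^e·h·f_E)`, `char_Λ X = (f_E)`; `μ_an = 0` gives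
`μ(h) = μ(f_E) = 0`; so `λ(h) + λ(f_E) = 3`. Gross–Zagier–Kolyvagin: `rank E(ℚ) = 1`, `Ш(E/ℚ)`
finite, hence `corank_{ℤ_p} Sel_{p^∞}(E/ℚ) = 1` and `λ(f_E)` is ODD (Greenberg Prop. 3.10 — no
reduction hypothesis): `λ(f_E) ∈ {1, 3}`. If `λ(f_E) = 1`, then `ord_T f_E = 1 = rank` (Jones clause
(1) `T ∣ f_E`, `ord_T ≤ λ`), so by Stein–Wuthrich 2013 Thm. 6.1 (2)–(3) THE §4.2 height is
non-degenerate and `[T¹]f_E · log_p(κγ)^{1+e} · #tors² ∼ A · #Ш[p^∞] · Reg_p · ∏c_ℓ` (`A = 𝓛_p` split,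
`2` non-split) with `[T¹]f_E ∈ ℤ_pˣ`; valuations give `1 + e + 2·ord_p #tors ≥ e·k + v + ord_p ∏c_ℓ`
for any certified `k ≤ ord_p 𝓛_p`, `v ≤ ord_p Reg_p` — so the per-pair inequality
`1 + e + 2·ord_p #tors < e·k + v + ord_p ∏c_ℓ` excludes it, `λ(f_E) = 3`, `λ(h) = 0`, `h ∈ Λˣ`:
Mazur's main conjecture at the pair (`X2.MazurMainConjectureAt W p`).

* `mazurMainConjectureAt_of_routeP_rankOne` (data level), `cellC_mazurMainConjectureAt_of_routeP`
  (sub-cell form). The regulator bound is asked only of a NON-DEGENERATE datum (`Reg_p ≠ 0 → v ≤ …`),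
  which is what an engine certifies.
* Conclusion = the CYCLOTOMIC main conjecture at a rank-one multiplicative Eisenstein pair (in print
  for no class of such pairs; Keller–Yin 2024 Thm. 5.0.4 is anticyclotomic and PRE). `BSD(E,p)` is NOT
  claimed: at λ-excess `2` it needs, besides `ord_p Reg_p`, the leading coefficient `[T^{1+e}](ϖL)`
  — lever L3 (`Typed.X2.bsdp_of_thm16mult_*_of_canonical_certificate`), which already closes every
  census pair with `p ∤ #Ш_an`; the value added here is the main-conjecture instance.
Census reach (iw-2 `tables/census.tsv`, N < 2·10⁴, two engines, all with `μ_an = 0`): X2c pairs with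
λ-excess `2`: 142 split (`λ_an = 4`) + 20 non-split (`λ_an = 3`) = 162 of 705 (next: excess `4`, 33
pairs). Nothing booked; candidates for the referee (two-engine `(μ, λ)` table + `ord_p Reg_p`, R93.3).

References: [GreenbergLNM1716] Prop. 3.10, §5 p. 183; [Wuthrich2014] Thm. 16; [SteinWuthrich2013]
Thm. 6.1 (p. 20), §3.1, eq. (3.4), §4.2, §4.4; [GreenbergVatsal2000] (1)–(2), p. 4;
[Iwasawa1972PadicL] §4.4; HOME/b2b-bsdres-eisenstein-p2/X2-GAP.md §10.
-/

set_option autoImplicit false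

noncomputable section

open scoped Classical MatrixGroups ModularForm

open PowerSeries CongruenceSubgroup WeierstrassCurve Literature.NumberTheory.EllipticCurves
  Literature.NumberTheory.EllipticCurves.ModularForms
  Literature.NumberTheory.EllipticCurves.Rank1Residual
  Literature.NumberTheory.EllipticCurves.Rank1Residual.Typed
  Literature.NumberTheory.EllipticCurves.Wuthrich2014
  Literature.NumberTheory.EllipticCurves.SteinWuthrich2013
  Literature.NumberTheory.EllipticCurves.Greenberg1999
  Summit.BirchSwinnertonDyer.Rank1Residual.X1.MuLambda
  Summit.BirchSwinnertonDyer.Rank1Residual.X1.MuPart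
  Summit.BirchSwinnertonDyer.Rank1Residual.X1.ParitySqueeze
  Summit.BirchSwinnertonDyer.Rank1Residual.X1.RankOneParitySqueeze

namespace Summit.BirchSwinnertonDyer.Rank1Residual.X2

/-! ## §1. Algebra: the odd squeeze -/

section Algebra

variable {p : ℕ} [Fact p.Prime]

/-- **The rank-one parity squeeze with a prefactor (pure algebra).** `u, h, f ∈ Λ` nonzero,
`λ(u) = k`, `μ(u·h·f) = 0`, `λ(u·h·f) = k + 3`, `λ(f)` odd and `λ(f) ≠ 1` ⇒ `h ∈ Λˣ` and `λ(f) = 3`.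
[cite: GreenbergLNM1716, §5 p. 183 (Conductor = 147, p = 13)] [cite: GreenbergVatsal2000, p. 4] -/
theorem isUnit_of_lam_mul_mul_eq_three {u h f : IwasawaAlgebra p} {k : ℕ} (hu : u ≠ 0) (hh : h ≠ 0)
    (hf : f ≠ 0) (hlu : lam u = k) (hμ : mu (u * (h * f)) = 0) (hl : lam (u * (h * f)) = k + 3)
    (hodd : Odd (lam f)) (hne : lam f ≠ 1) : IsUnit h ∧ lam f = 3 := by
  obtain ⟨-, hμh, -⟩ := mu_eq_zero_of_mu_mul_mul_eq_zero hu hh hf hμ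
  rw [lam_mul hu (mul_ne_zero hh hf), lam_mul hh hf, hlu] at hl
  obtain ⟨j, hj⟩ := hodd
  have hlf : lam f = 3 := by omega
  have hlh : lam h = 0 := by omega
  exact ⟨(isUnit_iff_mu_eq_zero_and_lam_eq_zero h).mpr ⟨hh, hμh, hlh⟩, hlf⟩

end Algebra

/-! ## §2. Route P at rank one, `p ‖ N` -/

section RouteP

variable {W : WeierstrassCurve ℚ} [W.IsElliptic] [W.IsGloballyMinimal] {p : ℕ} [Fact p.Prime]

/-- **Route P at `p ‖ N`, RANK ONE: Mazur's main conjecture at `(E,p)` from `μ_an = 0`,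
`λ_an = 3 + e`, a certified lower bound on the `p`-adic regulator of THE §4.2 height and a
Tamagawa / `𝓛`-invariant inequality.** Data: `W/ℚ` globally minimal elliptic, `p ≠ 2` of
multiplicative reduction, `E[p]` reducible, `ord_{s=1}L(E,s) = 1`. PUBLISHED named facts
(hypotheses): Wuthrich 2014 Thm. 16 (`hWu`), Stein–Wuthrich 2013 Thm. 6.1 with THE §4.2 heights
(`hJs hJn hHs hHn`), Greenberg 1999 Prop. 3.10 (`h310`), Gross–Zagier–Kolyvagin (`hGZK`). Per-pair
data: `AnalyticMuLE W p 0`; at a non-split prime `AnalyticLambdaEq W p 3` and `v` with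
`Reg_p ≠ 0 → v ≤ ord_p Reg_p(E,Dh)` and `1 + 2·ord_p #tors < v + ord_p ∏c_ℓ` (`hlamN`, `hbn`); at a
split prime `AnalyticLambdaEq W p 4` and `k, v` with `k ≤ ord_p 𝓛_p`, `Reg_p ≠ 0 → v ≤ ord_p Reg_p`,
`2 + 2·ord_p #tors < k + v + ord_p ∏c_ℓ` (`hlamS`, `hbs`). Conclusion `X2.MazurMainConjectureAt W p`;
proof in the module docstring. [cite: GreenbergLNM1716, Prop. 3.10 and §5 p. 183]
[cite: Wuthrich2014, Thm. 16 and §5 (p. 397)] [cite: SteinWuthrich2013, Thm. 6.1 (p. 20), §3.1 (p. 9), eq. (3.4) (p. 11), §4.2, §4.4 (p. 18)]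
[cite: GreenbergVatsal2000, p. 4 (after Thm. (1.2))] [cite: Iwasawa1972PadicL, §4.4] -/
theorem mazurMainConjectureAt_of_routeP_rankOne
    (hWu : thm16_charIdeal_dvd_multiplicative_of_reducible)
    (hJs : thm61_splitMultiplicative) (hJn : thm61_nonsplitMultiplicative)
    (hHs : exists_isSplitMultCanonical) (hHn : exists_isMultCanonical)
    (h310 : prop310_selmerCorank_mod_two_eq_lambdaInvariant)
    (hGZK : rank_eq_analyticRank_of_analyticRank_le_one)
    (W : WeierstrassCurve ℚ) [W.IsElliptic] [W.IsGloballyMinimal] (p : ℕ) [Fact p.Prime]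
    (hp2 : p ≠ 2) (hmult : W.HasMultiplicativeReductionAtPrime p)
    (hred : ¬ W.HasIrreducibleModPGaloisRep p) (hr : W.analyticRank = 1)
    (hμ0 : AnalyticMuLE W p 0)
    (hlamN : ¬ W.HasSplitMultiplicativeReductionAtPrime p → AnalyticLambdaEq W p 3)
    (hbn : ¬ W.HasSplitMultiplicativeReductionAtPrime p → ∃ v : ℤ,
      (∀ (q : ℚ_[p]) (Dh : PAdicHeightData W p), q ≠ 0 → ‖q‖ < 1 → tateJ q = (W.j : ℚ_[p]) →
        IsMultCanonical Dh q → padicRegulator Dh ≠ 0 → v ≤ (padicRegulator Dh).valuation) ∧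
      1 + 2 * (padicValNat p W.torsionOrder : ℤ) < v + padicValNat p W.tamagawaProduct)
    (hlamS : W.HasSplitMultiplicativeReductionAtPrime p → AnalyticLambdaEq W p 4)
    (hbs : W.HasSplitMultiplicativeReductionAtPrime p → ∃ k v : ℤ,
      (∀ Dq : TateParameterData W p, k ≤ (LInvariant Dq).valuation) ∧
      (∀ (Dq : TateParameterData W p) (Dh : PAdicHeightData W p), IsSplitMultCanonical Dh Dq →
        padicRegulator Dh ≠ 0 → v ≤ (padicRegulator Dh).valuation) ∧
      2 + 2 * (padicValNat p W.torsionOrder : ℤ) < k + v + padicValNat p W.tamagawaProduct) :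
    X2.MazurMainConjectureAt W p := by
  intro κ γ hκ hγ hγ' N _ f hf D ϖ hϖ
  have hpP : p.Prime := Fact.out
  haveI : Module.Finite (IwasawaAlgebra p) D.X := D.module_finite_holds hγ
  -- Wuthrich Thm. 16 at this datum; a generator `fE` of the characteristic ideal
  obtain ⟨hX, hKns, hKs⟩ := hWu W p hp2 hmult hred hκ hγ hγ' hf D ϖ hϖ
  haveI : (Literature.NumberTheory.EllipticCurves.Module.charIdeal (IwasawaAlgebra p) D.X).IsPrincipal :=
    charIdeal_isPrincipal_holds p D.X
  obtain ⟨fE, hfE⟩ := Submodule.IsPrincipal.principal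
    (Literature.NumberTheory.EllipticCurves.Module.charIdeal (IwasawaAlgebra p) D.X)
  have hchar : D.charIdeal = Ideal.span {fE} := hfE
  -- Gross–Zagier–Kolyvagin: rank one, `Ш` finite; `corank Sel_{p^∞}(E/ℚ) = 1`; `λ(fE)` is ODD
  obtain ⟨hrank, hfinsha⟩ := hGZK W hr.le
  have hr1 : W.mordellWeilRank = 1 := hrank.trans hr
  haveI : Finite W.sha := hfinsha
  have hfinp : Finite (AddCommGroup.primaryComponent W.sha p) := inferInstance
  have hcork : W.selmerCorank p = 1 := by
    rw [selmerCorank_eq_mordellWeilRank_of_finite_shaPrimary W p hfinp, hr1]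
  have hodd_of : fE ≠ 0 → Odd (lam fE) := fun hfE0 ↦ by
    rw [lam_generator_eq_lambdaInvariant D.X hX hfE0 hchar]
    exact prop310_selmerCorank_mod_two_eq_lambdaInvariant.odd_lambdaInvariant_of_selmerCorank_eq_one
      h310 W p hp2 hκ hγ D hX hcork
  -- bookkeeping quantities and their valuations
  obtain ⟨hlog0, hlogv⟩ := valuation_padicLog_cyclotomicGenerator (p := p) hp2
  set T : ℚ_[p] := (W.torsionOrder : ℚ_[p]) with hT
  set S : ℚ_[p] := (Nat.card (AddCommGroup.primaryComponent W.sha p) : ℚ_[p]) with hS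
  set Cv : ℚ_[p] := (W.tamagawaProduct : ℚ_[p]) with hCv
  have hT0 : T ≠ 0 := by rw [hT]; exact_mod_cast (W.torsionOrder_pos_holds).ne'
  have hS0 : S ≠ 0 := by rw [hS]; exact_mod_cast Nat.card_pos.ne'
  have hCv0 : Cv ≠ 0 := by rw [hCv]; exact_mod_cast (W.tamagawaProduct_pos').ne'
  have hvT : T.valuation = (padicValNat p W.torsionOrder : ℤ) := by rw [hT, Padic.valuation_natCast]
  have hvC : Cv.valuation = (padicValNat p W.tamagawaProduct : ℤ) := by
    rw [hCv, Padic.valuation_natCast]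
  have hvS : 0 ≤ S.valuation := by
    rw [hS, Padic.valuation_natCast]; exact_mod_cast Nat.zero_le _
  -- how the certificates at `G = u · (h · fE)` finish, given `λ(fE) ≠ 1` whenever `μ(fE) = 0`
  have finish : ∀ (u h : IwasawaAlgebra p) (k : ℕ) (L : PowerSeries ℚ_[p]), u ≠ 0 → lam u = k →
      iwasawaToPowerSeries p (u * (h * fE)) = PowerSeries.C ((ϖ : ℚ) : ℚ_[p]) * L →
      (∃ k' : ℕ, (p : ℝ) ^ (-(((0 : ℕ) : ℤ) + 1)) <
        ‖PowerSeries.coeff k' (PowerSeries.C ((ϖ : ℚ) : ℚ_[p]) * L)‖) →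
      lam (u * (h * fE)) = k + 3 → (fE ≠ 0 → mu fE = 0 → lam fE ≠ 1) → IsUnit h := by
    intro u h k L hu0 hlu hG hμ hlG hne1
    obtain ⟨k', hk'⟩ := hμ
    have hL0 : PowerSeries.C ((ϖ : ℚ) : ℚ_[p]) * L ≠ 0 := ne_zero_of_lt_norm_coeff hk'
    have hG0 : u * (h * fE) ≠ 0 := by
      intro h0; apply hL0; rw [← hG, h0, map_zero]
    have hh0 : h ≠ 0 := fun h0 ↦ hG0 (by rw [h0, zero_mul, mul_zero])
    have hfE0 : fE ≠ 0 := fun h0 ↦ hG0 (by rw [h0, mul_zero, mul_zero])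
    rw [← hG] at hk'
    have hμG : mu (u * (h * fE)) = 0 := Nat.le_zero.mp (mu_le_of_lt_norm_coeff hk')
    obtain ⟨-, -, hμfE⟩ := mu_eq_zero_of_mu_mul_mul_eq_zero hu0 hh0 hfE0 hμG
    exact (isUnit_of_lam_mul_mul_eq_three hu0 hh0 hfE0 hlu hμG hlG (hodd_of hfE0)
      (hne1 hfE0 hμfE)).1
  refine ⟨hX, fE, hchar, fun hsplit L hL => ?_, fun hns L hL => ?_⟩
  · /- SPLIT `p`: `ι(T · h · fE) = ϖ · L`, `λ = 1 + 3`; `λ(fE) = 1` is excluded by Jones'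
      formula with the `𝓛`-invariant: `2 + 2·ord_p #tors ≥ k + v + ord_p ∏c`. -/
    obtain ⟨Dq⟩ := (nonempty_tateParameterData_iff_holds (W := W) (p := p)).mpr hsplit
    obtain ⟨Dh, hDh⟩ := hHs W p hp2 Dq
    obtain ⟨hS1, hS2, hS3⟩ := hJs W p hp2 Dq κ γ hκ hγ hγ' D hX fE hchar Dh hDh
    rw [hr1] at hS1 hS2 hS3
    obtain ⟨k, v, hk, hv, hb⟩ := hbs hsplit
    have hne1 : fE ≠ 0 → mu fE = 0 → lam fE ≠ 1 := by
      intro hfE0 hμfE h1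
      have hordfE : fE.order = ((1 : ℕ) : ℕ∞) := by
        refine le_antisymm ?_ hS1
        have e := order_le_lam hfE0
        rwa [h1] at e
      obtain ⟨hSch, hfin'⟩ := hS2.mp hordfE
      obtain ⟨u, hu⟩ := hS3 hSch hfin'
      obtain ⟨hc0, hcval⟩ := valuation_coeff_lam hfE0
      rw [h1] at hc0 hcval
      rw [hμfE, Nat.cast_zero] at hcval
      have h𝓛0 : LInvariant Dq ≠ 0 := LInvariant_ne_zero_holds Dq
      have hRg0 : padicRegulator Dh ≠ 0 := hSch
      have hkq : k ≤ (LInvariant Dq).valuation := hk Dq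
      have hvR : v ≤ (padicRegulator Dh).valuation := hv Dq Dh hDh hRg0
      have hval := congrArg Padic.valuation hu
      rw [Padic.valuation_mul (mul_ne_zero hc0 (pow_ne_zero _ hlog0)) (pow_ne_zero 2 hT0),
        Padic.valuation_mul hc0 (pow_ne_zero _ hlog0), Padic.valuation_pow, Padic.valuation_pow,
        Padic.valuation_mul (coe_units_ne_zero p u)
          (mul_ne_zero h𝓛0 (mul_ne_zero (mul_ne_zero hS0 hRg0) hCv0)),
        valuation_coe_units_eq_zero, zero_add,
        Padic.valuation_mul h𝓛0 (mul_ne_zero (mul_ne_zero hS0 hRg0) hCv0),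
        Padic.valuation_mul (mul_ne_zero hS0 hRg0) hCv0, Padic.valuation_mul hS0 hRg0,
        hcval, hlogv, hvT, hvC] at hval
      push_cast at hval hb
      linarith
    obtain ⟨g, hgmem, hιg⟩ := hKs hsplit L hL
    have hgmem' : g ∈ Ideal.span {fE} := by rw [← hchar]; exact hgmem
    obtain ⟨h, hgh⟩ := Ideal.mem_span_singleton'.mp hgmem'
    have hG : iwasawaToPowerSeries p (PowerSeries.X * (h * fE)) =
        PowerSeries.C ((ϖ : ℚ) : ℚ_[p]) * L := by rw [hgh]; exact hιg
    have hlG : lam (PowerSeries.X * (h * fE)) = 1 + 3 :=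
      hlamS hsplit f hf ϖ hϖ L (fun _ ↦ hL) (fun hns ↦ absurd hsplit hns) _ hG
    have hunit : IsUnit h := finish PowerSeries.X h 1 L PowerSeries.X_ne_zero lam_X hG
      (hμ0 f hf ϖ hϖ L (fun _ ↦ hL) (fun hns ↦ absurd hsplit hns)) hlG hne1
    refine ⟨hunit.unit, ?_⟩
    rw [IsUnit.unit_spec, show (PowerSeries.X : IwasawaAlgebra p) * fE * h = PowerSeries.X * g by
      rw [← hgh]; ring]
    exact hιg
  · /- NON-SPLIT `p`: `ι(h · fE) = ϖ · L`, `λ = 0 + 3`; `λ(fE) = 1` is excluded by Jones' formula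
      with `ε_p = 2`: `1 + 2·ord_p #tors ≥ v + ord_p ∏c`. -/
    obtain ⟨q, ⟨hq0, hq1, hqj⟩, -⟩ := existsUnique_tateJ_eq_of_one_lt_norm
      (one_lt_norm_j_of_hasMultiplicativeReductionAtPrime (W := W) (p := p) hmult)
    obtain ⟨Dh, hDh⟩ := hHn W p hp2 hmult hns q hq0 hq1 hqj
    obtain ⟨hS1, hS2, hS3⟩ := hJn W p hp2 hmult hns q hq0 hq1 hqj κ γ hκ hγ hγ' D hX fE hchar Dh hDh
    rw [hr1] at hS1 hS2 hS3
    obtain ⟨v, hv, hb⟩ := hbn hns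
    have hne1 : fE ≠ 0 → mu fE = 0 → lam fE ≠ 1 := by
      intro hfE0 hμfE h1
      have hordfE : fE.order = ((1 : ℕ) : ℕ∞) := by
        refine le_antisymm ?_ hS1
        have e := order_le_lam hfE0
        rwa [h1] at e
      obtain ⟨hSch, hfin'⟩ := hS2.mp hordfE
      obtain ⟨u, hu⟩ := hS3 hSch hfin'
      obtain ⟨hc0, hcval⟩ := valuation_coeff_lam hfE0
      rw [h1] at hc0 hcval
      rw [hμfE, Nat.cast_zero] at hcval
      have h20 : (2 : ℚ_[p]) ≠ 0 := two_ne_zero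
      have hRg0 : padicRegulator Dh ≠ 0 := hSch
      have hvR : v ≤ (padicRegulator Dh).valuation := hv q Dh hq0 hq1 hqj hDh hRg0
      have hval := congrArg Padic.valuation hu
      rw [pow_one, Padic.valuation_mul (mul_ne_zero hc0 hlog0) (pow_ne_zero 2 hT0),
        Padic.valuation_mul hc0 hlog0, Padic.valuation_pow,
        Padic.valuation_mul (coe_units_ne_zero p u)
          (mul_ne_zero h20 (mul_ne_zero (mul_ne_zero hS0 hRg0) hCv0)),
        valuation_coe_units_eq_zero, zero_add,
        Padic.valuation_mul h20 (mul_ne_zero (mul_ne_zero hS0 hRg0) hCv0),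
        Padic.valuation_mul (mul_ne_zero hS0 hRg0) hCv0, Padic.valuation_mul hS0 hRg0,
        valuation_two_eq_zero hp2, hcval, hlogv, hvT, hvC] at hval
      push_cast at hval hb
      linarith
    obtain ⟨g, hgmem, hιg⟩ := hKns hns L hL
    have hgmem' : g ∈ Ideal.span {fE} := by rw [← hchar]; exact hgmem
    obtain ⟨h, hgh⟩ := Ideal.mem_span_singleton'.mp hgmem'
    have hG : iwasawaToPowerSeries p (1 * (h * fE)) = PowerSeries.C ((ϖ : ℚ) : ℚ_[p]) * L := by
      rw [one_mul, hgh]; exact hιg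
    have hlG : lam (1 * (h * fE)) = 0 + 3 :=
      hlamN hns f hf ϖ hϖ L (fun hsplit ↦ absurd hsplit hns) (fun _ ↦ hL) _ hG
    have hunit : IsUnit h := finish 1 h 0 L one_ne_zero (lam_eq_zero_of_isUnit isUnit_one) hG
      (hμ0 f hf ϖ hϖ L (fun hsplit ↦ absurd hsplit hns) (fun _ ↦ hL)) hlG hne1
    refine ⟨hunit.unit, ?_⟩
    rw [IsUnit.unit_spec, show fE * h = g by rw [← hgh]; ring]
    exact hιg

/-- **Sub-cell form: on `CellC W p` (X2c), route P at `λ_an = 3 + e` ⇒ the CYCLOTOMIC main conjecture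
at the pair.** `BSD(E,p)` there is NOT claimed (lever L3). [cite: GreenbergLNM1716, Prop. 3.10 and §5 p. 183]
[cite: Wuthrich2014, Thm. 16] [cite: SteinWuthrich2013, Thm. 6.1 (p. 20)] -/
theorem cellC_mazurMainConjectureAt_of_routeP
    (hWu : thm16_charIdeal_dvd_multiplicative_of_reducible)
    (hJs : thm61_splitMultiplicative) (hJn : thm61_nonsplitMultiplicative)
    (hHs : exists_isSplitMultCanonical) (hHn : exists_isMultCanonical)
    (h310 : prop310_selmerCorank_mod_two_eq_lambdaInvariant)
    (hGZK : rank_eq_analyticRank_of_analyticRank_le_one)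
    (W : WeierstrassCurve ℚ) [W.IsElliptic] [W.IsGloballyMinimal] (p : ℕ) [Fact p.Prime]
    (hc : CellC W p) (hμ0 : AnalyticMuLE W p 0)
    (hlamN : ¬ W.HasSplitMultiplicativeReductionAtPrime p → AnalyticLambdaEq W p 3)
    (hbn : ¬ W.HasSplitMultiplicativeReductionAtPrime p → ∃ v : ℤ,
      (∀ (q : ℚ_[p]) (Dh : PAdicHeightData W p), q ≠ 0 → ‖q‖ < 1 → tateJ q = (W.j : ℚ_[p]) →
        IsMultCanonical Dh q → padicRegulator Dh ≠ 0 → v ≤ (padicRegulator Dh).valuation) ∧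
      1 + 2 * (padicValNat p W.torsionOrder : ℤ) < v + padicValNat p W.tamagawaProduct)
    (hlamS : W.HasSplitMultiplicativeReductionAtPrime p → AnalyticLambdaEq W p 4)
    (hbs : W.HasSplitMultiplicativeReductionAtPrime p → ∃ k v : ℤ,
      (∀ Dq : TateParameterData W p, k ≤ (LInvariant Dq).valuation) ∧
      (∀ (Dq : TateParameterData W p) (Dh : PAdicHeightData W p), IsSplitMultCanonical Dh Dq →
        padicRegulator Dh ≠ 0 → v ≤ (padicRegulator Dh).valuation) ∧
      2 + 2 * (padicValNat p W.torsionOrder : ℤ) < k + v + padicValNat p W.tamagawaProduct) :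
    X2.MazurMainConjectureAt W p :=
  mazurMainConjectureAt_of_routeP_rankOne hWu hJs hJn hHs hHn h310 hGZK W p hc.2.1 hc.2.2.2 hc.2.2.1
    hc.1 hμ0 hlamN hbn hlamS hbs

/-- **No rational `p`-torsion, non-split `p`**: the inequality of route P at rank one reads
`2 ≤ v + ord_p ∏c_ℓ` — e.g. `v = 2`, or `v = 1 ∧ p ∣ ∏c_ℓ` (the §4.2 height of an admissible point
lies in `pℤ_p`, so `v ≥ 1` is the generic certified value when the generator's admissible multiple
is prime to `p`). [cite: GreenbergLNM1716, §5 p. 183] [cite: SteinWuthrich2013, Thm. 6.1 (p. 20)] -/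
theorem mazurMainConjectureAt_of_routeP_rankOne_nonsplit_of_not_dvd_torsionOrder
    (hWu : thm16_charIdeal_dvd_multiplicative_of_reducible)
    (hJs : thm61_splitMultiplicative) (hJn : thm61_nonsplitMultiplicative)
    (hHs : exists_isSplitMultCanonical) (hHn : exists_isMultCanonical)
    (h310 : prop310_selmerCorank_mod_two_eq_lambdaInvariant)
    (hGZK : rank_eq_analyticRank_of_analyticRank_le_one)
    (W : WeierstrassCurve ℚ) [W.IsElliptic] [W.IsGloballyMinimal] (p : ℕ) [Fact p.Prime]
    (hp2 : p ≠ 2) (hmult : W.HasMultiplicativeReductionAtPrime p)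
    (hns : ¬ W.HasSplitMultiplicativeReductionAtPrime p)
    (hred : ¬ W.HasIrreducibleModPGaloisRep p) (hr : W.analyticRank = 1)
    (hμ0 : AnalyticMuLE W p 0) (hlam3 : AnalyticLambdaEq W p 3)
    (htors : ¬ p ∣ W.torsionOrder) {v : ℤ}
    (hv : ∀ (q : ℚ_[p]) (Dh : PAdicHeightData W p), q ≠ 0 → ‖q‖ < 1 → tateJ q = (W.j : ℚ_[p]) →
      IsMultCanonical Dh q → padicRegulator Dh ≠ 0 → v ≤ (padicRegulator Dh).valuation)
    (hb : 2 ≤ v + padicValNat p W.tamagawaProduct) :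
    X2.MazurMainConjectureAt W p := by
  have ht0 : padicValNat p W.torsionOrder = 0 := padicValNat.eq_zero_of_not_dvd htors
  refine mazurMainConjectureAt_of_routeP_rankOne hWu hJs hJn hHs hHn h310 hGZK W p hp2 hmult hred hr
    hμ0 (fun _ ↦ hlam3) (fun _ ↦ ⟨v, hv, ?_⟩) (fun hs ↦ absurd hs hns) (fun hs ↦ absurd hs hns)
  rw [ht0, Nat.cast_zero, mul_zero, add_zero]
  linarith

end RouteP

end Summit.BirchSwinnertonDyer.Rank1Residual.X2

end
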